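import Summits.Parity.GeneralizedHardyLittlewood.Theorems.LiouvilleShiftedTablesTypeI2DilatedAssemble3

/-!
# THE ASSEMBLY of the line `peel-to-drappeau` for the crux `TypeI2Dilated` (stmt-Parity-14272)

Part 4/6: regrouping the dispersion range by the smooth component `P = (s, (qr|c|)^∞)` (`sum_filter_smoothComponent_eq`) and the Rankin tail `P > P_m` (`tail_bound`).

Route `LiouvilleShiftedTables` (Parity / GeneralizedHardyLittlewood); registered skeleton
`Cruxes/TypeI2Dilated/Lines/peel-to-drappeau.lean` (v6), stub `stub_assembleFrom : AssembleFrom` where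
`AssembleFrom := URBound → (DilatedTypeII → DilatedMainTerms → DilatedDivisorAP → BVLiouville → TypeI2Dilated)`
(vocabulary in `Summits.Parity.GeneralizedHardyLittlewood.Theorems.LiouvilleShiftedTablesDefs`).  The paper proof with constants and the audit of the four inputs is the
second module docstring of part 5. [this line: Lines/peel-to-drappeau.md]
-/

noncomputable section

namespace Summit.Parity.GeneralizedHardyLittlewood.Cruxes.TypeI2Dilated.PeelToDrappeau

open Finset Real
open scoped ArithmeticFunction.sigma Classical
open Literature.NumberTheory.Sieve Literature.NumberTheory.Sieve.Drappeau2017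
  Literature.NumberTheory.Sieve.FouvryTenenbaum2021 Literature.NumberTheory.Sieve.DispersionAssembly
open Summit.Parity.GeneralizedHardyLittlewood.Theses.LiouvilleShiftedTables (TypeI2Dilated BVLiouville)

/-- L6 — regrouping the dispersion range by the smooth part (Step 3): for `q, r ≥ 1`, `c ≠ 0`,
`N = q r |c|`, summing `F` over `S' < s ≤ S` with `(s, N^∞) ≤ Pm` is summing `F(P s₃)` over `P ≤ Pm`,
`P ∣ N^∞`, `s₃ ∈ sRange c q (rP) (S'/P) (S/P)`. [this line] -/
theorem sum_filter_smoothComponent_eq {c : ℤ} (hc : c ≠ 0) {q r : ℕ} (hq : 1 ≤ q) (hr : 1 ≤ r)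
    (S' S : ℝ) (Pm : ℕ) {M : Type*} [AddCommMonoid M] (F : ℕ → M) :
    ∑ s ∈ (Icc 1 ⌊S⌋₊).filter (fun s : ℕ => S' < (s : ℝ) ∧ smoothComponent (q * r * c.natAbs) s ≤ Pm), F s =
      ∑ P ∈ (Icc 1 Pm).filter
          (fun P : ℕ => P ∈ Nat.factoredNumbers (q * r * c.natAbs).primeFactors),
        ∑ t ∈ sRange c q (r * P) (S' / P) (S / P), F (P * t) := by
  set N := q * r * c.natAbs with hN
  have hc' : c.natAbs ≠ 0 := Int.natAbs_ne_zero.2 hc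
  have hN0 : N ≠ 0 := by positivity
  rw [Finset.sum_sigma']
  refine Finset.sum_nbij' (fun s => (⟨smoothComponent N s, roughComponent N s⟩ : Σ _ : ℕ, ℕ))
    (fun x => x.1 * x.2) ?_ ?_ ?_ ?_ ?_
  · -- `s ↦ (P, t)` lands in the index set
    intro s hs
    rw [Finset.mem_filter, Finset.mem_Icc] at hs
    obtain ⟨⟨hs1, hsS⟩, hS's, hPm⟩ := hs
    have hs0 : s ≠ 0 := by omega
    have hdec := smoothComponent_mul_roughComponent N hs0
    have hP0 : 0 < smoothComponent N s := Nat.pos_of_ne_zero (smoothComponent_ne_zero N s)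
    have hP0R : (0 : ℝ) < smoothComponent N s := by exact_mod_cast hP0
    have hsR : ((smoothComponent N s : ℕ) : ℝ) * (roughComponent N s : ℕ) = s := by exact_mod_cast hdec
    have hspos : (0 : ℝ) < s := by exact_mod_cast hs1
    have hsS' : (s : ℝ) ≤ S := (Nat.le_floor_iff' hs0).1 hsS
    rw [Finset.mem_sigma, Finset.mem_filter, Finset.mem_Icc]
    refine ⟨⟨⟨hP0, hPm⟩, smoothComponent_mem_factoredNumbers hN0 s⟩, ?_⟩
    have hcopN := roughComponent_coprime N s
    simp only [sRange, Finset.mem_filter, Finset.mem_Icc]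
    refine ⟨⟨Nat.pos_of_ne_zero (roughComponent_ne_zero N s), ?_⟩, ?_, ?_, ?_⟩
    · rw [Nat.le_floor_iff' (roughComponent_ne_zero N s), le_div_iff₀ hP0R]
      nlinarith [hsR, hsS']
    · rw [div_lt_iff₀ hP0R]
      nlinarith [hsR, hS's]
    · -- coprime to `q * (r * P)`
      have hq' : Nat.Coprime (roughComponent N s) q :=
        hcopN.coprime_dvd_right ⟨r * c.natAbs, by rw [hN]; ring⟩
      have hr' : Nat.Coprime (roughComponent N s) r :=
        hcopN.coprime_dvd_right ⟨q * c.natAbs, by rw [hN]; ring⟩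
      have hP' : Nat.Coprime (roughComponent N s) (smoothComponent N s) :=
        (coprime_of_mem_factoredNumbers_primeFactors (smoothComponent_mem_factoredNumbers hN0 s) hcopN).symm
      exact Nat.Coprime.mul_right hq' (Nat.Coprime.mul_right hr' hP')
    · rw [isCoprime_natCast_int_iff]
      exact hcopN.coprime_dvd_right ⟨q * r, by rw [hN]; ring⟩
  · -- `(P, t) ↦ P t` lands in the `s`-set
    rintro ⟨P, t⟩ hx
    rw [Finset.mem_sigma, Finset.mem_filter, Finset.mem_Icc] at hx
    obtain ⟨⟨⟨hP1, hPPm⟩, hPfac⟩, ht⟩ := hx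
    simp only [sRange, Finset.mem_filter, Finset.mem_Icc] at ht
    obtain ⟨⟨ht1, htS⟩, hS't, hcop, hcopc⟩ := ht
    have hP0R : (0 : ℝ) < P := by exact_mod_cast hP1
    have htS' : (t : ℝ) ≤ S / P := (Nat.le_floor_iff' (by omega)).1 htS
    have htN : Nat.Coprime t N := by
      rw [hN]
      refine Nat.Coprime.mul_right (Nat.Coprime.mul_right ?_ ?_) ?_
      · exact Nat.Coprime.coprime_dvd_right ⟨r * P, by ring⟩ hcop
      · exact Nat.Coprime.coprime_dvd_right ⟨q * P, by ring⟩ hcop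
      · exact (isCoprime_natCast_int_iff t c).1 hcopc
    have hPt0 : P * t ≠ 0 := by positivity
    obtain ⟨hsm, -⟩ := smoothComponent_eq_of_mul_eq hN0 hPt0 hPfac htN rfl
    rw [Finset.mem_filter, Finset.mem_Icc]
    refine ⟨⟨Nat.pos_of_ne_zero hPt0, ?_⟩, ?_, by simpa [hsm] using hPPm⟩
    · rw [Nat.le_floor_iff' hPt0, Nat.cast_mul]
      rw [le_div_iff₀ hP0R] at htS'
      linarith
    · rw [Nat.cast_mul]
      rw [div_lt_iff₀ hP0R] at hS't
      linarith
  · -- left inverse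
    intro s hs
    rw [Finset.mem_filter, Finset.mem_Icc] at hs
    exact smoothComponent_mul_roughComponent N (by omega)
  · -- right inverse
    rintro ⟨P, t⟩ hx
    rw [Finset.mem_sigma, Finset.mem_filter, Finset.mem_Icc] at hx
    obtain ⟨⟨⟨hP1, -⟩, hPfac⟩, ht⟩ := hx
    simp only [sRange, Finset.mem_filter, Finset.mem_Icc] at ht
    obtain ⟨⟨ht1, -⟩, -, hcop, hcopc⟩ := ht
    have htN : Nat.Coprime t N := by
      rw [hN]
      refine Nat.Coprime.mul_right (Nat.Coprime.mul_right ?_ ?_) ?_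
      · exact Nat.Coprime.coprime_dvd_right ⟨r * P, by ring⟩ hcop
      · exact Nat.Coprime.coprime_dvd_right ⟨q * P, by ring⟩ hcop
      · exact (isCoprime_natCast_int_iff t c).1 hcopc
    have hPt0 : P * t ≠ 0 := by positivity
    obtain ⟨hsm, hrg⟩ := smoothComponent_eq_of_mul_eq hN0 hPt0 hPfac htN rfl
    simp only [hsm, hrg]
  · -- summands agree
    intro s hs
    rw [Finset.mem_filter, Finset.mem_Icc] at hs
    simp only [smoothComponent_mul_roughComponent N (by omega : s ≠ 0)]

/-- L7 — the large-smooth-part tail (Step 3, Rankin): for `x ≥ 3`, `Q ≤ x`, `0 ≤ R, S ≤ x`, `0 ≤ Y`,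
`Pm ≥ 1`: `∑_{q ≤ Q} ∑_{r ≤ R} ∑_{s ≤ S, (s,N^∞) > Pm} (Y/(rs) + 1) ≤ C (Q Y Pm^{-1/2} (log x)^17 + Q R S log x)`.
[this line] -/
theorem tail_bound {c : ℤ} (hc : c ≠ 0) :
    ∃ C : ℝ, 0 < C ∧ ∀ x : ℝ, 3 ≤ x → ∀ Q Pm : ℕ, 1 ≤ Pm → (Q : ℝ) ≤ x →
      ∀ R S Y : ℝ, 0 ≤ R → R ≤ x → 0 ≤ S → S ≤ x → 0 ≤ Y →
      ∑ q ∈ Icc 1 Q, ∑ r ∈ Icc 1 ⌊R⌋₊,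
          ∑ s ∈ (Icc 1 ⌊S⌋₊).filter (fun s : ℕ => Pm < smoothComponent (q * r * c.natAbs) s),
            (Y / ((r : ℝ) * s) + 1) ≤
        C * ((Q : ℝ) * Y * (Pm : ℝ) ^ (-(1 / 2 : ℝ)) * Real.log x ^ (17 : ℕ) +
          (Q : ℝ) * R * S * Real.log x) := by
  obtain ⟨C₂, hC₂, h2⟩ := exists_sum_sigma_zero_pow_le_real 2
  obtain ⟨C₃, hC₃, h3⟩ := exists_sum_sigma_zero_pow_div_le_real 2
  norm_num at h2 h3
  set τc : ℝ := (σ 0 c.natAbs : ℝ) with hτc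
  have hc' : c.natAbs ≠ 0 := Int.natAbs_ne_zero.2 hc
  refine ⟨4 * C₂ * C₃ * τc ^ 2 + 1, by positivity, ?_⟩
  intro x hx Q Pm hPm hQx R S Y hR0 hRx hS0 hSx hY0
  set L := Real.log x with hL
  have hL1 : 1 ≤ L := log_one_le_of_three_le hx
  have hx0 : 0 < x := by linarith
  -- split the summand
  rw [Finset.sum_congr rfl fun q _ => Finset.sum_congr rfl fun r _ => Finset.sum_add_distrib,
    Finset.sum_congr rfl fun q _ => Finset.sum_add_distrib, Finset.sum_add_distrib]
  -- Part B: the number of terms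
  have hB : ∑ q ∈ Icc 1 Q, ∑ r ∈ Icc 1 ⌊R⌋₊,
      ∑ _s ∈ (Icc 1 ⌊S⌋₊).filter (fun s : ℕ => Pm < smoothComponent (q * r * c.natAbs) s), (1 : ℝ) ≤
      (Q : ℝ) * R * S := by
    calc ∑ q ∈ Icc 1 Q, ∑ r ∈ Icc 1 ⌊R⌋₊,
          ∑ _s ∈ (Icc 1 ⌊S⌋₊).filter (fun s : ℕ => Pm < smoothComponent (q * r * c.natAbs) s), (1 : ℝ)
        ≤ ∑ q ∈ Icc 1 Q, ∑ r ∈ Icc 1 ⌊R⌋₊, ∑ _s ∈ Icc 1 ⌊S⌋₊, (1 : ℝ) := by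
          gcongr with q _ r _
          exact Finset.filter_subset _ _
      _ = (Q : ℝ) * ⌊R⌋₊ * ⌊S⌋₊ := by
          simp only [Finset.sum_const, Nat.card_Icc, add_tsub_cancel_right, nsmul_eq_mul, mul_one]
          ring
      _ ≤ (Q : ℝ) * R * S := by
          gcongr
          · exact Nat.floor_le hR0
          · exact Nat.floor_le hS0
  -- Part A: per `(q, r)`
  have hS' : ∑ t ∈ Icc 1 ⌊S⌋₊, (1 : ℝ) / t ≤ 2 * L := by
    have h1 : ∑ t ∈ Icc 1 ⌊S⌋₊, (1 : ℝ) / t ≤ 1 + Real.log ⌊S⌋₊ := by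
      simpa [one_div] using harmonic_Icc_le ⌊S⌋₊
    have h2' : Real.log ⌊S⌋₊ ≤ L := by
      rcases Nat.eq_zero_or_pos ⌊S⌋₊ with h0 | h0
      · rw [h0, Nat.cast_zero, Real.log_zero]; linarith
      · exact Real.log_le_log (by exact_mod_cast h0) ((Nat.floor_le hS0).trans hSx)
    linarith
  have hA : ∀ q ∈ Icc 1 Q, ∀ r ∈ Icc 1 ⌊R⌋₊,
      ∑ s ∈ (Icc 1 ⌊S⌋₊).filter (fun s : ℕ => Pm < smoothComponent (q * r * c.natAbs) s),
        Y / ((r : ℝ) * s) ≤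
      Y * (Pm : ℝ) ^ (-(1 / 2 : ℝ)) * τc ^ 2 * (2 * L) * (σ 0 q : ℝ) ^ 2 * ((σ 0 r : ℝ) ^ 2 / r) := by
    intro q hq r hr
    rw [Finset.mem_Icc] at hq hr
    have hq0 : q ≠ 0 := by omega
    have hr0 : r ≠ 0 := by omega
    have hN0 : q * r * c.natAbs ≠ 0 := by positivity
    have hrpos : (0 : ℝ) < r := by exact_mod_cast hr.1
    have e1 : ∀ s : ℕ, Y / ((r : ℝ) * s) = Y / r * ((1 : ℝ) / s) := by
      intro s; rw [div_mul_div_comm, mul_one, ← div_div]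
    rw [Finset.sum_congr rfl fun s _ => e1 s, ← Finset.mul_sum]
    have hkey := sum_inv_filter_smoothComponent_le hN0 hPm S
    have hω : (4 : ℝ) ^ (q * r * c.natAbs).primeFactors.card ≤
        (σ 0 q : ℝ) ^ 2 * (σ 0 r : ℝ) ^ 2 * τc ^ 2 := by
      refine (four_pow_card_primeFactors_le_sigma_zero_sq hN0).trans ?_
      have hm : (σ 0 (q * r * c.natAbs) : ℝ) ≤ (σ 0 q : ℝ) * σ 0 r * σ 0 c.natAbs := by
        have h1 := sigma_zero_mul_le (q * r) c.natAbs
        have h2 := sigma_zero_mul_le q r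
        calc (σ 0 (q * r * c.natAbs) : ℝ) ≤ (σ 0 (q * r) : ℝ) * σ 0 c.natAbs := by exact_mod_cast h1
          _ ≤ ((σ 0 q : ℝ) * σ 0 r) * σ 0 c.natAbs := by gcongr; exact_mod_cast h2
      calc (σ 0 (q * r * c.natAbs) : ℝ) ^ 2 ≤ ((σ 0 q : ℝ) * σ 0 r * σ 0 c.natAbs) ^ 2 := by gcongr
        _ = (σ 0 q : ℝ) ^ 2 * (σ 0 r : ℝ) ^ 2 * τc ^ 2 := by rw [hτc]; ring
    calc Y / r * ∑ s ∈ (Icc 1 ⌊S⌋₊).filter (fun s : ℕ => Pm < smoothComponent (q * r * c.natAbs) s),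
          (1 : ℝ) / s
        ≤ Y / r * ((Pm : ℝ) ^ (-(1 / 2 : ℝ)) * (4 : ℝ) ^ (q * r * c.natAbs).primeFactors.card *
            ∑ t ∈ Icc 1 ⌊S⌋₊, (1 : ℝ) / t) := mul_le_mul_of_nonneg_left hkey (by positivity)
      _ ≤ Y / r * ((Pm : ℝ) ^ (-(1 / 2 : ℝ)) * ((σ 0 q : ℝ) ^ 2 * (σ 0 r : ℝ) ^ 2 * τc ^ 2) *
            (2 * L)) := by
          gcongr
      _ = Y * (Pm : ℝ) ^ (-(1 / 2 : ℝ)) * τc ^ 2 * (2 * L) * (σ 0 q : ℝ) ^ 2 * ((σ 0 r : ℝ) ^ 2 / r) := by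
          rw [div_eq_mul_inv, div_eq_mul_inv]; ring
  -- the divisor sums
  have hsumr : ∑ r ∈ Icc 1 ⌊R⌋₊, (σ 0 r : ℝ) ^ 2 / r ≤ C₃ * L ^ 8 := by
    have hR2 : (2 : ℝ) ≤ max R 2 := le_max_right _ _
    have hsub : Icc 1 ⌊R⌋₊ ⊆ Icc 1 ⌊max R 2⌋₊ :=
      Finset.Icc_subset_Icc le_rfl (Nat.floor_mono (le_max_left _ _))
    calc ∑ r ∈ Icc 1 ⌊R⌋₊, (σ 0 r : ℝ) ^ 2 / r ≤ ∑ r ∈ Icc 1 ⌊max R 2⌋₊, (σ 0 r : ℝ) ^ 2 / r :=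
          Finset.sum_le_sum_of_subset_of_nonneg hsub fun _ _ _ => by positivity
      _ ≤ C₃ * Real.log (max R 2) ^ 8 := h3 _ hR2
      _ ≤ C₃ * L ^ 8 := by
          have h0 : 0 ≤ Real.log (max R 2) := Real.log_nonneg (by linarith)
          have h1 : Real.log (max R 2) ≤ L := Real.log_le_log (by linarith) (max_le hRx (by linarith))
          exact mul_le_mul_of_nonneg_left (pow_le_pow_left₀ h0 h1 8) hC₃.le
  have hsumq : ∑ q ∈ Icc 1 Q, (σ 0 q : ℝ) ^ 2 ≤ 2 * C₂ * Q * L ^ 8 := by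
    rcases Nat.eq_zero_or_pos Q with hQ0 | hQ0
    · rw [hQ0]; simp
    have hQ1 : (1 : ℝ) ≤ Q := by exact_mod_cast hQ0
    have hQ2 : (2 : ℝ) ≤ max (Q : ℝ) 2 := le_max_right _ _
    have hsub : Icc 1 Q ⊆ Icc 1 ⌊max (Q : ℝ) 2⌋₊ := by
      refine Finset.Icc_subset_Icc le_rfl ?_
      calc Q = ⌊(Q : ℝ)⌋₊ := (Nat.floor_natCast Q).symm
        _ ≤ ⌊max (Q : ℝ) 2⌋₊ := Nat.floor_mono (le_max_left _ _)
    calc ∑ q ∈ Icc 1 Q, (σ 0 q : ℝ) ^ 2 ≤ ∑ q ∈ Icc 1 ⌊max (Q : ℝ) 2⌋₊, (σ 0 q : ℝ) ^ 2 :=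
          Finset.sum_le_sum_of_subset_of_nonneg hsub fun _ _ _ => by positivity
      _ ≤ C₂ * max (Q : ℝ) 2 * Real.log (max (Q : ℝ) 2) ^ 8 := h2 _ hQ2
      _ ≤ C₂ * (2 * Q) * L ^ 8 := by
          have h0 : 0 ≤ Real.log (max (Q : ℝ) 2) := Real.log_nonneg (by linarith)
          have h1 : Real.log (max (Q : ℝ) 2) ≤ L :=
            Real.log_le_log (by linarith) (max_le hQx (by linarith))
          have hm : max (Q : ℝ) 2 ≤ 2 * Q := max_le (by linarith) (by linarith)
          have hp : Real.log (max (Q : ℝ) 2) ^ 8 ≤ L ^ 8 := pow_le_pow_left₀ h0 h1 8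
          have : C₂ * max (Q : ℝ) 2 ≤ C₂ * (2 * Q) := mul_le_mul_of_nonneg_left hm hC₂.le
          exact mul_le_mul this hp (by positivity) (by positivity)
      _ = 2 * C₂ * Q * L ^ 8 := by ring
  have hAtot : ∑ q ∈ Icc 1 Q, ∑ r ∈ Icc 1 ⌊R⌋₊,
      ∑ s ∈ (Icc 1 ⌊S⌋₊).filter (fun s : ℕ => Pm < smoothComponent (q * r * c.natAbs) s),
        Y / ((r : ℝ) * s) ≤
      4 * C₂ * C₃ * τc ^ 2 * ((Q : ℝ) * Y * (Pm : ℝ) ^ (-(1 / 2 : ℝ)) * L ^ (17 : ℕ)) := by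
    calc ∑ q ∈ Icc 1 Q, ∑ r ∈ Icc 1 ⌊R⌋₊,
          ∑ s ∈ (Icc 1 ⌊S⌋₊).filter (fun s : ℕ => Pm < smoothComponent (q * r * c.natAbs) s),
            Y / ((r : ℝ) * s)
        ≤ ∑ q ∈ Icc 1 Q, ∑ r ∈ Icc 1 ⌊R⌋₊,
            Y * (Pm : ℝ) ^ (-(1 / 2 : ℝ)) * τc ^ 2 * (2 * L) * (σ 0 q : ℝ) ^ 2 * ((σ 0 r : ℝ) ^ 2 / r) :=
          Finset.sum_le_sum fun q hq => Finset.sum_le_sum fun r hr => hA q hq r hr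
      _ = Y * (Pm : ℝ) ^ (-(1 / 2 : ℝ)) * τc ^ 2 * (2 * L) *
            ((∑ q ∈ Icc 1 Q, (σ 0 q : ℝ) ^ 2) * ∑ r ∈ Icc 1 ⌊R⌋₊, (σ 0 r : ℝ) ^ 2 / r) := by
          rw [Finset.sum_mul_sum]
          simp only [Finset.mul_sum]
          refine Finset.sum_congr rfl fun q _ => Finset.sum_congr rfl fun r _ => ?_
          ring
      _ ≤ Y * (Pm : ℝ) ^ (-(1 / 2 : ℝ)) * τc ^ 2 * (2 * L) * ((2 * C₂ * Q * L ^ 8) * (C₃ * L ^ 8)) := by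
          have hq0 : 0 ≤ ∑ q ∈ Icc 1 Q, (σ 0 q : ℝ) ^ 2 := Finset.sum_nonneg fun _ _ => by positivity
          have hr0 : 0 ≤ ∑ r ∈ Icc 1 ⌊R⌋₊, (σ 0 r : ℝ) ^ 2 / r :=
            Finset.sum_nonneg fun _ _ => by positivity
          have hprod := mul_le_mul hsumq hsumr hr0 (by positivity)
          exact mul_le_mul_of_nonneg_left hprod (by positivity)
      _ = 4 * C₂ * C₃ * τc ^ 2 * ((Q : ℝ) * Y * (Pm : ℝ) ^ (-(1 / 2 : ℝ)) * L ^ (17 : ℕ)) := by ring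
  -- combine
  have hX1 : 0 ≤ (Q : ℝ) * Y * (Pm : ℝ) ^ (-(1 / 2 : ℝ)) * L ^ (17 : ℕ) := by positivity
  have hX2 : 0 ≤ (Q : ℝ) * R * S := by positivity
  have hK : 0 ≤ 4 * C₂ * C₃ * τc ^ 2 := by positivity
  calc _ ≤ 4 * C₂ * C₃ * τc ^ 2 * ((Q : ℝ) * Y * (Pm : ℝ) ^ (-(1 / 2 : ℝ)) * L ^ (17 : ℕ)) +
          (Q : ℝ) * R * S := add_le_add hAtot hB
    _ ≤ (4 * C₂ * C₃ * τc ^ 2 + 1) *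
          ((Q : ℝ) * Y * (Pm : ℝ) ^ (-(1 / 2 : ℝ)) * L ^ (17 : ℕ) + (Q : ℝ) * R * S * L) := by
          nlinarith [mul_nonneg hK hX2, mul_nonneg hX2 (by linarith : (0 : ℝ) ≤ L - 1)]

/-- Landing anchor of the split assembly chain (file 4 of 6): a registered, mathematically vacuous sub-goal
(`ledger workitem stub-add … --name assembleChain4_anchor --signature 'True'`) so that this intermediate file passes
the gate's supports check; the registered stub `stub_assembleFrom` is proved in file 6. [this line] -/
theorem assembleChain4_anchor : True := trivial

end Summit.Parity.GeneralizedHardyLittlewood.Cruxes.TypeI2Dilated.PeelToDrappeau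

end
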